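import Summits.Ventures.Crystal3D.Theorems.StickyWulffConstantGenericWallFloorExitCount
import Summits.Ventures.Crystal3D.Theorems.StickyWulffConstantGenericWallFloorSealing
import HarnessLib

/-!
# Exits on grain sites, and where they live in the co-axial cell (first general-filling brick of line F)

HONEST FRAMING. Part of the venture `Summits/Ventures/Crystal3D` (cell `crystal3d-full`), helper
`--supports` the crux `CoaxialWallLaw` (stmt-Ventures-19481, `route-Ventures-StickyWulffConstant`),
REGISTERED line `WallLedgerF` (planner cf-p1 gen 16), stub `stub_coaxialTwoSlabAdhesion`.
Brick F-N1 of the general-filling port (folder memo '## General-filling mechanism'): lane G's source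
count `card_exits_ge` (19480-p1, `…GenericWallFloorExitCount`) counts the `u`-EXITS of a grain
`Λ = A·Λ₀ + t` in an ARBITRARY filling `X` (balls `e ∈ X` whose predecessor `e − A u ∈ X` has its full
shell while `e` lacks a slot).  For translation pairs (`A₁·Λ₀ = A₂·Λ₀`) the complete TOP sample produces
exits of grain 1 at its own top face, so line F needs the exits ON GRAIN-1 SITES and BELOW the top sample:

* `card_exits_onGrain_ge` — the same flux bound for the exits lying on the sites of `Λ` (the run tops
  reached from the inner sample along `A u` are lattice translates of sample sites; `card_runTops_le`
  records the ray);
* `mem_topSample_of_ge` — SEALING: in a unit-separated filling, every ball of height `≥ a` and lateral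
  radius `≤ ρ − 1` belongs to the top sample `P₂` (complete on `[a, b] × disc ρ`, `a + 2 ≤ b`);
* `exit_onGrain_below` — hence, for DISJOINT grains, a ball of `X` on a grain-1 site off the rim lies
  strictly below the top sample (`e₂ < a`).

Rung credit only; F-C1 not moved.  WHAT THIS IS NOT: exits still have to be paid (`exit_trichotomy`)
and followed through coincidence terraces (bricks F-N2/F-N3 of the memo).
-/

noncomputable section

namespace Summit.Ventures.Crystal3D.Theorems

open Summit.Ventures.Crystal3D Finset
open Literature.MathematicalPhysics.StatisticalMechanics (fccStacking)
open scoped InnerProductSpace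

open scoped Classical in
/-- **Exits on grain sites are at least a flux.**  As `card_exits_ge`, counting only exits `e ∈ Λ`. -/
theorem card_exits_onGrain_ge
    (A : EuclideanSpace ℝ (Fin 3) ≃ₗᵢ[ℝ] EuclideanSpace ℝ (Fin 3)) (t : EuclideanSpace ℝ (Fin 3))
    (X P : Finset (EuclideanSpace ℝ (Fin 3))) (R₀ ρ : ℝ) (hR₀ : 3 ≤ R₀) (hρ : R₀ ≤ ρ) (hPX : P ⊆ X)
    (hP : ∀ p, p ∈ P ↔ (p ∈ (fun q => A q + t) '' fccStacking 1 (Real.sqrt (2 / 3)) ∧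
      -(2 * R₀) ≤ p 2 ∧ p 2 ≤ -R₀ ∧ p 0 ^ 2 + p 1 ^ 2 ≤ ρ ^ 2))
    {u : EuclideanSpace ℝ (Fin 3)} (hu : u ∈ fccSlots) :
    Real.sqrt 2 * |⟪A u, EuclideanSpace.single (2 : Fin 3) (1 : ℝ)⟫_ℝ| * Real.pi * (ρ - 1) ^ 2 -
        10 * Real.sqrt 2 * Real.pi * (ρ - 1) ≤
      (((X.filter fun e => e ∈ (fun q => A q + t) '' fccStacking 1 (Real.sqrt (2 / 3)) ∧
          e - A u ∈ X ∧ (∀ w ∈ fccSlots, e - A u + A w ∈ X) ∧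
          ∃ v ∈ fccSlots, e + A v ∉ X).card : ℕ) : ℝ) := by
  have hρ1 : (1 : ℝ) ≤ ρ := by linarith
  -- the full-shell sub-configuration and the inner sample
  obtain ⟨D, hD⟩ : ∃ D : Finset (EuclideanSpace ℝ (Fin 3)),
      D = X.filter (fun q => ∀ w ∈ fccSlots, q + A w ∈ X) := ⟨_, rfl⟩
  obtain ⟨P', hP'def⟩ : ∃ P' : Finset (EuclideanSpace ℝ (Fin 3)), P' = P.filter (fun p =>
      -(2 * R₀) + 1 ≤ p 2 ∧ p 2 ≤ -R₀ - 1 ∧ p 0 ^ 2 + p 1 ^ 2 ≤ (ρ - 1) ^ 2) := ⟨_, rfl⟩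
  have hP' : ∀ p, p ∈ P' ↔ (p ∈ (fun q => A q + t) '' fccStacking 1 (Real.sqrt (2 / 3)) ∧
      (-(2 * R₀) + 1) ≤ p 2 ∧ p 2 ≤ (-(2 * R₀) + 1) + (R₀ - 2) ∧ p 0 ^ 2 + p 1 ^ 2 ≤ (ρ - 1) ^ 2) := by
    intro p
    rw [hP'def, mem_filter, hP]
    constructor
    · rintro ⟨⟨hΛ, -, -, -⟩, h1, h2, h3⟩
      exact ⟨hΛ, h1, by linarith, h3⟩
    · rintro ⟨hΛ, h1, h2, h3⟩
      have hρ0 : (0 : ℝ) ≤ ρ - 1 := by linarith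
      refine ⟨⟨hΛ, by linarith, by linarith, ?_⟩, h1, by linarith, h3⟩
      nlinarith
  have hP'D : P' ⊆ D := by
    intro p hp
    obtain ⟨hΛ, h1, h2, h3⟩ := (hP' p).1 hp
    rw [hD, mem_filter]
    refine ⟨hPX ((hP _).2 ?_), fun w hw => hPX (inner_sample_full A t P R₀ ρ hρ1 hP hΛ h1 (by linarith) h3 hw)⟩
    have hρ0 : (0 : ℝ) ≤ ρ - 1 := by linarith
    exact ⟨hΛ, by linarith, by linarith, by nlinarith⟩
  -- line tops of the inner sample
  obtain ⟨Ea, Eb, hEa, hEb, hdet, hframe, -⟩ := exists_frame_of_mem_fccSlots hu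
  have h1 := tops_ge_lineCount A t (-(2 * R₀) + 1) (R₀ - 2) (ρ - 1) (by linarith) (by linarith) P' hP'
    Ea Eb u hEa hEb (norm_eq_one_of_mem_fccSlots hu) hdet hframe
  -- tops of maximal full-shell runs from the inner sample, remembered to lie on a ray from `P'`
  have hu0 : A u ≠ 0 := by
    intro h0
    have : ‖A u‖ = 0 := by rw [h0, norm_zero]
    rw [LinearIsometryEquiv.norm_map, norm_eq_one_of_mem_fccSlots hu] at this
    norm_num at this
  have hP'eq : ∀ p, p ∈ P' ↔ (p ∈ (fun q => A q + t) '' fccStacking 1 (Real.sqrt (2 / 3)) ∧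
      (-(2 * R₀) + 1) ≤ p 2 ∧ p 2 ≤ -R₀ - 1 ∧ p 0 ^ 2 + p 1 ^ 2 ≤ (ρ - 1) ^ 2) := by
    intro p; rw [hP' p, show -(2 * R₀) + 1 + (R₀ - 2) = -R₀ - 1 by ring]
  have h2 := card_runTops_le D P' (A u) hu0 hP'D
    (runConvex_clampedSample A t (-(2 * R₀) + 1) (-R₀ - 1) (ρ - 1) (by linarith) P' hP'eq
      (mem_fcc_of_mem_fccSlots hu))
  -- (re-state with this file's decidability instances)
  have h2' : (P'.filter fun p => p + A u ∉ P').card ≤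
      (D.filter fun q => q + A u ∉ D ∧ ∃ p ∈ P', ∃ m : ℕ, q = p + ((m : ℕ) : ℝ) • A u).card := by
    convert h2 using 3
  -- successors of these tops are distinct exits on grain sites
  have h3 : (D.filter fun q => q + A u ∉ D ∧ ∃ p ∈ P', ∃ m : ℕ, q = p + ((m : ℕ) : ℝ) • A u).card ≤
      (X.filter fun e => e ∈ (fun q => A q + t) '' fccStacking 1 (Real.sqrt (2 / 3)) ∧
        e - A u ∈ X ∧ (∀ w ∈ fccSlots, e - A u + A w ∈ X) ∧
        ∃ v ∈ fccSlots, e + A v ∉ X).card := by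
    refine Finset.card_le_card_of_injOn (fun q => q + A u) ?_ ?_
    · intro q hq
      rw [Finset.mem_coe, mem_filter] at hq
      obtain ⟨hqD, hnot, p, hp, m, hqe⟩ := hq
      rw [hD, mem_filter] at hqD
      obtain ⟨hqX, hfull⟩ := hqD
      have heX : q + A u ∈ X := hfull u hu
      -- `q`, hence `q + A u`, is a grain site
      have hpΛ : p ∈ (fun q => A q + t) '' fccStacking 1 (Real.sqrt (2 / 3)) := ((hP' p).1 hp).1
      have hqΛ : q ∈ (fun q => A q + t) '' fccStacking 1 (Real.sqrt (2 / 3)) := by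
        rw [hqe]
        clear hqe hnot hfull hqX heX
        induction m with
        | zero => simpa using hpΛ
        | succ n ih =>
          have e : p + ((n + 1 : ℕ) : ℝ) • A u = (p + ((n : ℕ) : ℝ) • A u) + A u := by
            push_cast; rw [add_smul, one_smul, add_assoc]
          rw [e]
          exact movedFcc_add_site_mem A t ih (mem_fcc_of_mem_fccSlots hu)
      rw [Finset.mem_coe, mem_filter]
      refine ⟨heX, movedFcc_add_site_mem A t hqΛ (mem_fcc_of_mem_fccSlots hu),
        by rw [add_sub_cancel_right]; exact hqX,
        fun w hw => by rw [add_sub_cancel_right]; exact hfull w hw, ?_⟩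
      by_contra hall
      push Not at hall
      apply hnot
      rw [hD, mem_filter]
      exact ⟨heX, hall⟩
    · intro q _ q' _ h
      exact add_right_cancel h
  have h1' : Real.sqrt 2 * |⟪A u, EuclideanSpace.single (2 : Fin 3) (1 : ℝ)⟫_ℝ| * Real.pi * (ρ - 1) ^ 2 -
      10 * Real.sqrt 2 * Real.pi * (ρ - 1) ≤ (((P'.filter fun p => p + A u ∉ P').card : ℕ) : ℝ) := by
    convert h1 using 3
  have hcast : (((P'.filter fun p => p + A u ∉ P').card : ℕ) : ℝ) ≤
      (((X.filter fun e => e ∈ (fun q => A q + t) '' fccStacking 1 (Real.sqrt (2 / 3)) ∧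
        e - A u ∈ X ∧ (∀ w ∈ fccSlots, e - A u + A w ∈ X) ∧
        ∃ v ∈ fccSlots, e + A v ∉ X).card : ℕ) : ℝ) := by
    exact_mod_cast h2'.trans h3
  exact h1'.trans hcast

/-- **Sealing by the top sample.**  In a unit-separated filling, a ball of height `≥ a` and lateral
radius `≤ ρ − 1` belongs to the sample `P` complete on `[a, b] × disc ρ` (`a + 2 ≤ b`, all balls of
`X` have height `≤ b`). -/
theorem mem_topSample_of_ge
    (A : EuclideanSpace ℝ (Fin 3) ≃ₗᵢ[ℝ] EuclideanSpace ℝ (Fin 3)) (t : EuclideanSpace ℝ (Fin 3))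
    (a b ρ : ℝ) (hab : a + 2 ≤ b) (hρ : 1 ≤ ρ) (X P : Finset (EuclideanSpace ℝ (Fin 3)))
    (hX : ∀ p ∈ X, ∀ q ∈ X, p ≠ q → 1 ≤ dist p q) (hPX : P ⊆ X)
    (hP : ∀ p, p ∈ P ↔ (p ∈ (fun s => A s + t) '' fccStacking 1 (Real.sqrt (2 / 3)) ∧
      a ≤ p 2 ∧ p 2 ≤ b ∧ p 0 ^ 2 + p 1 ^ 2 ≤ ρ ^ 2))
    (htop : ∀ p ∈ X, p 2 ≤ b)
    (q : EuclideanSpace ℝ (Fin 3)) (hqX : q ∈ X) (ha : a ≤ q 2) (hr : q 0 ^ 2 + q 1 ^ 2 ≤ (ρ - 1) ^ 2) :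
    q ∈ P := by
  by_cases h1 : a + 1 ≤ q 2
  · by_contra hqP
    exact sealing_above A t a b ρ hρ X P hX hPX hP q hqX hqP h1 (htop q hqX) hr
  · push Not at h1
    have hρ' : (ρ - 1) ^ 2 ≤ ρ ^ 2 := by nlinarith
    by_cases hqΛ : q ∈ (fun s => A s + t) '' fccStacking 1 (Real.sqrt (2 / 3))
    · exact (hP q).2 ⟨hqΛ, ha, htop q hqX, hr.trans hρ'⟩
    exfalso
    obtain ⟨v, hvΛ, hd, hz⟩ := movedFcc_exists_near_above A t q hqΛ
    have hd2 : dist v q ^ 2 < 1 := by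
      rw [dist_comm] at hd
      have := pow_lt_pow_left₀ hd dist_nonneg (two_ne_zero)
      simpa using this
    have hsq := dist_sq_eq_three v q
    have hz' : v 2 < q 2 + 1 := by nlinarith [sq_nonneg (v 0 - q 0), sq_nonneg (v 1 - q 1)]
    have hlat : v 0 ^ 2 + v 1 ^ 2 ≤ ρ ^ 2 := by
      have := lateral_sq_le_of_dist_le_one (y := v) (q := q) (r := ρ - 1) (by linarith) hr
        (by rw [dist_comm]; exact hd.le)
      simpa using this
    have hvP : v ∈ P := (hP v).2 ⟨hvΛ, by linarith, by linarith, hlat⟩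
    have hne : v ≠ q := fun h => hqΛ (h ▸ hvΛ)
    have := hX v (hPX hvP) q hqX hne
    rw [dist_comm] at this
    linarith

/-- **Exits of grain 1 on grain-1 sites lie below the top sample** (disjoint grains).  In the cell of
`CoaxialTwoSlabAdhesion` (top sample `P₂` of `Λ₂` complete on `[h + R₀, h + 2R₀] × disc ρ`, `2 ≤ R₀`),
a ball of `X` on a site of `Λ₁`, `Λ₁ ∩ Λ₂ = ∅`, with lateral radius `≤ ρ − 1` has height `< h + R₀`. -/
theorem onGrain_below_topSample
    (A₁ : EuclideanSpace ℝ (Fin 3) ≃ₗᵢ[ℝ] EuclideanSpace ℝ (Fin 3)) (t₁ : EuclideanSpace ℝ (Fin 3))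
    (A₂ : EuclideanSpace ℝ (Fin 3) ≃ₗᵢ[ℝ] EuclideanSpace ℝ (Fin 3)) (t₂ : EuclideanSpace ℝ (Fin 3))
    (hdisj : ∀ p ∈ (fun q => A₁ q + t₁) '' fccStacking 1 (Real.sqrt (2 / 3)),
      p ∉ (fun q => A₂ q + t₂) '' fccStacking 1 (Real.sqrt (2 / 3)))
    (X P₂ : Finset (EuclideanSpace ℝ (Fin 3))) (R₀ h ρ : ℝ) (hR₀ : 2 ≤ R₀) (hρ : 1 ≤ ρ)
    (hX : ∀ p ∈ X, ∀ q ∈ X, p ≠ q → 1 ≤ dist p q) (hP₂X : P₂ ⊆ X)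
    (hcell : ∀ p ∈ X, -(2 * R₀) ≤ p 2 ∧ p 2 ≤ h + 2 * R₀ ∧ p 0 ^ 2 + p 1 ^ 2 ≤ ρ ^ 2)
    (hP₂ : ∀ p, p ∈ P₂ ↔ (p ∈ (fun q => A₂ q + t₂) '' fccStacking 1 (Real.sqrt (2 / 3)) ∧
      h + R₀ ≤ p 2 ∧ p 2 ≤ h + 2 * R₀ ∧ p 0 ^ 2 + p 1 ^ 2 ≤ ρ ^ 2))
    {e : EuclideanSpace ℝ (Fin 3)} (heX : e ∈ X)
    (heΛ : e ∈ (fun q => A₁ q + t₁) '' fccStacking 1 (Real.sqrt (2 / 3)))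
    (hr : e 0 ^ 2 + e 1 ^ 2 ≤ (ρ - 1) ^ 2) : e 2 < h + R₀ := by
  by_contra hge
  push Not at hge
  have heP := mem_topSample_of_ge A₂ t₂ (h + R₀) (h + 2 * R₀) ρ (by linarith) hρ X P₂ hX hP₂X hP₂
    (fun p hp => (hcell p hp).2.1) e heX hge hr
  exact hdisj e heΛ ((hP₂ e).1 heP).1

open scoped Classical in
/-- **F-N1.**  For DISJOINT co-axial (indeed arbitrary disjoint) grains, the `u`-exits of grain 1 on
grain-1 sites that lie strictly below the top sample and off the rim number at least the flux minus a rim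
term: `flux·π(ρ−1)² − 10√2π(ρ−1) − #{rim balls of X}`. -/
theorem card_exits_onGrain_below_ge
    (A₁ : EuclideanSpace ℝ (Fin 3) ≃ₗᵢ[ℝ] EuclideanSpace ℝ (Fin 3)) (t₁ : EuclideanSpace ℝ (Fin 3))
    (A₂ : EuclideanSpace ℝ (Fin 3) ≃ₗᵢ[ℝ] EuclideanSpace ℝ (Fin 3)) (t₂ : EuclideanSpace ℝ (Fin 3))
    (hdisj : ∀ p ∈ (fun q => A₁ q + t₁) '' fccStacking 1 (Real.sqrt (2 / 3)),
      p ∉ (fun q => A₂ q + t₂) '' fccStacking 1 (Real.sqrt (2 / 3)))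
    (X P₁ P₂ : Finset (EuclideanSpace ℝ (Fin 3))) (R₀ h ρ : ℝ) (hR₀ : 3 ≤ R₀) (hρ : R₀ ≤ ρ)
    (hX : ∀ p ∈ X, ∀ q ∈ X, p ≠ q → 1 ≤ dist p q) (hP₁X : P₁ ⊆ X) (hP₂X : P₂ ⊆ X)
    (hcell : ∀ p ∈ X, -(2 * R₀) ≤ p 2 ∧ p 2 ≤ h + 2 * R₀ ∧ p 0 ^ 2 + p 1 ^ 2 ≤ ρ ^ 2)
    (hP₁ : ∀ p, p ∈ P₁ ↔ (p ∈ (fun q => A₁ q + t₁) '' fccStacking 1 (Real.sqrt (2 / 3)) ∧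
      -(2 * R₀) ≤ p 2 ∧ p 2 ≤ -R₀ ∧ p 0 ^ 2 + p 1 ^ 2 ≤ ρ ^ 2))
    (hP₂ : ∀ p, p ∈ P₂ ↔ (p ∈ (fun q => A₂ q + t₂) '' fccStacking 1 (Real.sqrt (2 / 3)) ∧
      h + R₀ ≤ p 2 ∧ p 2 ≤ h + 2 * R₀ ∧ p 0 ^ 2 + p 1 ^ 2 ≤ ρ ^ 2))
    {u : EuclideanSpace ℝ (Fin 3)} (hu : u ∈ fccSlots) :
    Real.sqrt 2 * |⟪A₁ u, EuclideanSpace.single (2 : Fin 3) (1 : ℝ)⟫_ℝ| * Real.pi * (ρ - 1) ^ 2 -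
        10 * Real.sqrt 2 * Real.pi * (ρ - 1) -
        (((X.filter fun x => (ρ - 2) ^ 2 < x 0 ^ 2 + x 1 ^ 2).card : ℕ) : ℝ) ≤
      (((X.filter fun e => e ∈ (fun q => A₁ q + t₁) '' fccStacking 1 (Real.sqrt (2 / 3)) ∧
          e 2 < h + R₀ ∧
          e - A₁ u ∈ X ∧ (∀ w ∈ fccSlots, e - A₁ u + A₁ w ∈ X) ∧
          ∃ v ∈ fccSlots, e + A₁ v ∉ X).card : ℕ) : ℝ) := by
  have hρ1 : (1 : ℝ) ≤ ρ := by linarith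
  have h1 := card_exits_onGrain_ge A₁ t₁ X P₁ R₀ ρ hR₀ hρ hP₁X hP₁ hu
  -- split the on-grain exits into rim / non-rim; the non-rim ones lie below the top sample
  set EX := X.filter fun e => e ∈ (fun q => A₁ q + t₁) '' fccStacking 1 (Real.sqrt (2 / 3)) ∧
      e - A₁ u ∈ X ∧ (∀ w ∈ fccSlots, e - A₁ u + A₁ w ∈ X) ∧ ∃ v ∈ fccSlots, e + A₁ v ∉ X with hEX
  set RIM := X.filter fun x => (ρ - 2) ^ 2 < x 0 ^ 2 + x 1 ^ 2 with hRIM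
  set GOOD := X.filter fun e => e ∈ (fun q => A₁ q + t₁) '' fccStacking 1 (Real.sqrt (2 / 3)) ∧
      e 2 < h + R₀ ∧ e - A₁ u ∈ X ∧ (∀ w ∈ fccSlots, e - A₁ u + A₁ w ∈ X) ∧
      ∃ v ∈ fccSlots, e + A₁ v ∉ X with hGOOD
  have hsub : EX ⊆ GOOD ∪ RIM := by
    intro e he
    rw [hEX, mem_filter] at he
    obtain ⟨heX, heΛ, hpred, hfull, hlack⟩ := he
    rw [mem_union]
    by_cases hrim : (ρ - 2) ^ 2 < e 0 ^ 2 + e 1 ^ 2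
    · exact Or.inr (mem_filter.2 ⟨heX, hrim⟩)
    · push Not at hrim
      have hr : e 0 ^ 2 + e 1 ^ 2 ≤ (ρ - 1) ^ 2 := by nlinarith
      exact Or.inl (mem_filter.2 ⟨heX, heΛ, onGrain_below_topSample A₁ t₁ A₂ t₂ hdisj X P₂ R₀ h ρ
        (by linarith) hρ1 hX hP₂X hcell hP₂ heX heΛ hr, hpred, hfull, hlack⟩)
  have hcard : EX.card ≤ GOOD.card + RIM.card := (card_le_card hsub).trans (card_union_le _ _)
  have hcast : ((EX.card : ℕ) : ℝ) ≤ ((GOOD.card : ℕ) : ℝ) + ((RIM.card : ℕ) : ℝ) := by exact_mod_cast hcard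
  linarith

end Summit.Ventures.Crystal3D.Theorems

end
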